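import Mathlib
import HarnessLib
import Summits.ValiantsHypothesis.ValiantsHypothesis.Theses.MonotoneRestoration
import Literature.Computability.AlgebraicComplexity.ArithCircuit
import Literature.Computability.AlgebraicComplexity.ArithCircuitProofs
import Literature.Computability.AlgebraicComplexity.MonotoneStructure
import Literature.Computability.AlgebraicComplexity.PermanentIrreducible
import Literature.ModelTheory.FiniteModelTheory.CkEquiv
import Summits.ValiantsHypothesis.ValiantsHypothesis.Theorems.MonotoneRestorationMonotoneRestorationQPCosetCount
import Summits.ValiantsHypothesis.ValiantsHypothesis.Theorems.MonotoneRestorationMonotoneRestorationQPSymmetricLB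
import Summits.ValiantsHypothesis.ValiantsHypothesis.Theorems.MonotoneRestorationMonotoneRestorationQPSupportSymmetrisation
import Summits.ValiantsHypothesis.ValiantsHypothesis.Theorems.MonotoneRestorationMonotoneRestorationQPSparseRegime
import Summits.ValiantsHypothesis.ValiantsHypothesis.Theorems.MonotoneRestorationMonotoneRestorationQPBeta
import Literature.Computability.AlgebraicComplexity.SymmetricArithCircuit
import Literature.Computability.AlgebraicComplexity.DawarWilsenach2025Proofs
import Literature.GroupTheory.PermutationGroups.SmallIndexSubgroups
import Summits.ValiantsHypothesis.ValiantsHypothesis.Theorems.MonotoneRestorationQP.Negative.LoadBearing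
import Summits.ValiantsHypothesis.ValiantsHypothesis.Theorems.MonotoneRestorationMonotoneRestorationQPPermSupportCount

/-! TTRL-lite variant V20725 of stmt-ValiantsHypothesis-15886 -/

namespace Summit.ValiantsHypothesis.ValiantsHypothesis.Theorems

open Summit.ValiantsHypothesis.ValiantsHypothesis.Theses.MonotoneRestoration
open Literature.Computability.AlgebraicComplexity

/-- Polynomial growth is eventually dominated by `2 ^ t`, with an arbitrary multiplicative
constant: for all `A d`, eventually `A * t ^ d ≤ 2 ^ t`. (TTRL-lite variant V20725 of the
`gammaArithmetic` stub of stmt-ValiantsHypothesis-15886.) -/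
theorem stub_gammaArithmetic_var20725 :
    ∀ (A d : ℕ), ∃ T : ℕ, ∀ t : ℕ, T ≤ t → A * t ^ d ≤ 2 ^ t := by
  intro A d
  -- `t ^ d / 2 ^ t → 0`, hence `A * (t ^ d / 2 ^ t) → 0`, so it is eventually `< 1`.
  have h0 : Filter.Tendsto (fun n : ℕ => (n : ℝ) ^ d / (2 : ℝ) ^ n) Filter.atTop (nhds 0) :=
    tendsto_pow_const_div_const_pow_of_one_lt d (by norm_num)
  have h1 : Filter.Tendsto (fun n : ℕ => (A : ℝ) * ((n : ℝ) ^ d / (2 : ℝ) ^ n))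
      Filter.atTop (nhds 0) := by
    simpa using h0.const_mul (A : ℝ)
  have h2 : ∀ᶠ n : ℕ in Filter.atTop, (A : ℝ) * ((n : ℝ) ^ d / (2 : ℝ) ^ n) < 1 :=
    h1.eventually (Iio_mem_nhds one_pos)
  obtain ⟨T, hT⟩ := Filter.eventually_atTop.1 h2
  refine ⟨T, fun t ht => ?_⟩
  have hpos : (0 : ℝ) < (2 : ℝ) ^ t := by positivity
  have h3 : (A : ℝ) * ((t : ℝ) ^ d / (2 : ℝ) ^ t) < 1 := hT t ht
  rw [← mul_div_assoc, div_lt_one hpos] at h3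
  exact_mod_cast h3.le

end Summit.ValiantsHypothesis.ValiantsHypothesis.Theorems
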